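import Summits.ValiantsHypothesis.ValiantsHypothesis.Theses.BarrierLever
import Summits.ValiantsHypothesis.ValiantsHypothesis.Theorems.BarrierLeverPartitionMinorsHitByVPHiddenStatesLargeK
import Summits.ValiantsHypothesis.ValiantsHypothesis.Theorems.BarrierLeverPartitionMinorsHitByVPHiddenStatesJoin
import Summits.ValiantsHypothesis.ValiantsHypothesis.Theorems.BarrierLeverPartitionMinorsHitByVPStubJoinDoorWide
import Summits.ValiantsHypothesis.ValiantsHypothesis.Theorems.BarrierLeverPartitionMinorsHitByVPHiddenStatesQstarCubeRefutation
import Summits.ValiantsHypothesis.ValiantsHypothesis.Theorems.BarrierLeverPartitionMinorsHitByVPHiddenStatesFit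
import Summits.ValiantsHypothesis.ValiantsHypothesis.Theorems.BarrierLeverPartitionMinorsHitByVPHiddenStatesAFit
import Summits.ValiantsHypothesis.ValiantsHypothesis.Theorems.BarrierLeverPartitionMinorsHitByVPHiddenStatesMajorityNode
import Summits.ValiantsHypothesis.ValiantsHypothesis.Theorems.BarrierLeverPartitionMinorsHitByVPHiddenStatesFullJoin
import Summits.ValiantsHypothesis.ValiantsHypothesis.Theorems.BarrierLeverPartitionMinorsHitByVPSimplexJoinNodes
import Summits.ValiantsHypothesis.ValiantsHypothesis.Theorems.BarrierLeverPartitionMinorsHitByVPUniformMenu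
import Summits.ValiantsHypothesis.ValiantsHypothesis.Theorems.BarrierLeverPartitionMinorsHitByVPHiddenStatesGadgetNode

/-!
# Skeleton line `hidden-states` for the crux `PartitionMinorsHitByVP` (stmt-ValiantsHypothesis-19717)
# of route `BarrierLever` — 𝒟-side door (c): HIDDEN-STATE / JOIN witnesses

Crux (item 19717, verbatim in `Theses/BarrierLever.lean`): for some `b, h₀` and every `h ≥ h₀`, every
partition-minor layout `(u, w)` (injective row / column families of subsets of `Fin h`) is hit by a
polynomial in `SmallCircuits ℂ (h+h) b` (nonzero layout determinant of its coefficient table).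

WHY THIS LINE. The hidden-state witnesses `F(tab, λ) = ∏_v (1 + tab none v·X_v) · ∏_k (1 + λ_k ∏_v (1 + tab (some k) v·X_v))`
(val-np-p3 g6/g7, `…HiddenStates*.lean`) and their JOINS `Σ_i κ_i F(tab_i, λ_i)` (g8, `…HiddenStatesJoin.lean`) reduce the
crux, by LANDED door theorems, to a unisolvence statement about ONE hidden family per size `r`: the block-additive matrix
`[∏_{a∈u i} (tx p none a + Σ_{q∈J} tx p (some q) a)]_{i,(p,J)=e k}` is nonsingular for some table, for EVERY injective `u`.
This is the only 𝒟-side door whose open hypothesis has survived every census of the cell (h ≤ 12 exhaustive/adversarial;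
the concentration and star/biclique obstructions that killed `K = h`, `K ≤ 2h` (CB, Q_join(2h): dead from h = 12) and the
parametric star family (`not_ballGood_pstar`, K = h+6) are vacuous once pieces carry `K ≥ h²` states — counting:
rank obstruction `(K+1) + C(h',2) + v(K−h'+1)` exceeds `N` for `K ≥ h²`).

WHY NOVEL (relative to the dead doors): exact-cover bricks (door (e)) are refuted asymptotically by Reed–Solomon pairs
(val-np-p1 g14, 2^{Ω(log² h)} bricks forced); Chow / ΠΣ witnesses with h+h forms (20172/20195) die by quadratic-direction
starvation (val-np-p2 g9); ROABP tables die by the thin-rows × binary-code argument (`RoabpDoor.not_ROABPHitsPartitionMinors`).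
Hidden-state witnesses are sums of products of SPARSE-SHIFTED affine products — outside all three classes (not read-once,
not a single Chow product, log-sparsity unbounded).

THE LINE (stubs → crux, composition `PartitionMinorsHitByVP_of` kernel-checked):
* `stub_joinDoorWide` — THE WIDE JOIN DOOR: the join door `HiddenStates.partitionMinor_hit_of_hiddenJoin_mem` re-budgeted
  for pieces with up to `h³` hidden states (`m ≤ 2h` pieces, `K ≤ h³`, `h ≥ 3` ⇒ `SmallCircuits ℂ (h+h) 8`; size arithmetic
  `(2h+2)²·(m(6h + K(6h+2) + K + 3) + m) + 2h + 1 ≤ 611 h⁷ ≤ (2h)⁸` for `h ≥ 3`). Routine, M-sized.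
* `stub_universalJoinWide` — THE CONJECTURE NODE: for `h ≥ h₁` and `r ≤ 2^h` ONE join threshold family (`m ≤ 2h` pieces of
  `K ≤ h³` states) is good for EVERY injective family `u`. Two named sufficient forms, each reduced to it IN THIS FILE (no sorry):
  - `stub_qstarCube` = **Q\*(h³)**, the conjecture OF RECORD (hypothesis of the landed door `partitionMinorsHitByVP_of_ballGood_cube`,
    p553048): one cube, `h ≤ Kf h ≤ h³` states, the ball–colex threshold family (`universalJoinWide_of_qstarCube`);
  - `stub_qjoinSharp` = **Q_join(h²)**, the SHARP KILLABLE VARIANT: a join family whose pieces carry exactly `h·h` states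
    (`universalJoinWide_of_qjoinSharp`).
* `PartitionMinorsHitByVP_of : Stmt.stub_joinDoorWide → Stmt.stub_universalJoinWide → PartitionMinorsHitByVP` (proved; `b = 8`), and the
  record door (p553048) — **v3: `stub_qstarCube` is REFUTED (p577137, `not_stub_qstarCube` below); the single-cube lane is closed.**
* **v4 (2026-08-28T00:35Z): third OPEN stub `stub_fit` = val-np-p3 g10's FITTING CONJECTURE F⁺** (`SymbJoin.Stmt.fitConjecture`, p588547,
  restated verbatim as `Stmt.stub_fit`): one legal wide join threshold family per `(h, r)` that is `Fit`-certified (an inductive tree of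
  hyperplane split steps, leaf = lonely columns) against EVERY injective `u` — a purely combinatorial sufficient form of the node; composition
  `PartitionMinorsHitByVP_of_fit := PartitionMinorsHitByVP_of ∘ SymbJoin.universalJoinWide_of_fitConjecture` (kernel-checked). STATE OF THE
  OTHER STUBS: `stub_universalJoinWide` (K ≤ h³) holds for r ≤ 2h(h³+1) = 2h⁴+2h by star joins (p578997 `universalJoinWide_of_le`, `…_upto_seventeen`) — open for h ≥ 18, r ∈ (2h⁴+2h, 2^h];
  `stub_qjoinSharp` proved ∀u for r ≤ 2h³+4h²+6h (p584941 axis table) and ∀ r ≤ 2^h for h ≤ 12 — open only for h ≥ 13, r > 2h³+4h²+6h.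
  Registered open stubs after v4: `stub_universalJoinWide`, `stub_qjoinSharp`, `stub_fit` (each ALONE closes the crux by a composition below).
* **v5 (2026-08-28T01:33Z, planner p1 g20): fourth OPEN stub `stub_afit` = val-np-p6 g8's COMBINATORIAL FITTING CONJECTURE AF⁺**
  (`SymbJoin.Stmt.afitConjecture`, p593109 `…HiddenStatesAFit.lean`, restated verbatim as `Stmt.stub_afit`): one legal wide join threshold family
  per `(h, r)` that is `AFit`-certified against EVERY injective `u` — `AFit` = the cut tree with AFFINELY-CLOSED split nodes (constants supplied by
  `exists_cut_of_affClosed`, p591478; node `symGood_of_affSplit`, p591757) and AFFINELY-FREE leaves (`symGood_of_affFree`, p589275) or `Fit` leaves;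
  `AFit ⊇ Fit`, so `stub_fit → stub_afit` (`stub_afit_of_fit`, from `SymbJoin.afitConjecture_of_fitConjecture`) and the new stub is the WEAKER,
  constant-free sufficient form; composition `PartitionMinorsHitByVP_of_afit := PartitionMinorsHitByVP_of ∘ SymbJoin.universalJoinWide_of_afitConjecture`
  (kernel-checked). Census (p6 g8 memo MEMO-cuttree-valnp6-g8.md; kit j295199–213, j295398, j296060/064/275): the fully-peeled greedy-ball design is
  AFit-certified on every tested down-set h ≤ 9 (adaptive order); in the BALL GAME abstraction (Pascal cuts only) it wins h ≤ 9 all (fixed order x = last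
  misses 2/283 at h = 9, won adaptively). Registered open stubs after v5: `stub_universalJoinWide`, `stub_qjoinSharp`, `stub_fit`, `stub_afit`.
* **v6 (2026-08-28T03:08Z, planner p1 g20): the LOWER-SET NODE (val-np-p6 g9, p599518 `…HiddenStatesLowerNode.lean` ACCEPTED 6ff53f60a77a).**
  REGISTRY CORRECTION: the v1–v5 stubs quantify over ALL injective row families `u`, while every conjecture and census of the cell
  (F⁺-PEEL, AF⁺, WBALL-LADDER) is about DOWN-SETS and the crux needs LOWER PAIRS only (`DownCompression.partitionMinorsHitByVP_of_lowerSets`).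
  Two new OPEN stubs, verbatim the bodies of p6 g9's typed defs: `stub_afitLower` (= `LowerNode.Stmt.afitLower`: AF⁺ with `IsLowerSet (Set.range u)`
  added — the weaker sufficient form that matches the conjectures as studied; `stub_afit → stub_afitLower`) and `stub_pairJoinWideLower`
  (= `LowerNode.Stmt.pairJoinWideLower`: the WEAKEST hypothesis the wide join door accepts — for every LOWER PAIR `(u, w)` ONE legal wide design,
  depending on the pair, good on the `u`-side AND on the `w`-side; implied by every other stub of the line). Compositions through p6 g9's landed
  `LowerNode.partitionMinorsHitByVP_of_afitLower` / `_of_pairJoinWideLower` (b = 12 wide join door + down-compression), kernel-checked here.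
  p6 g9 census (02:48–03:06Z): the full-peel design is GOOD and ball-game-certified on NON-down-sets too (parity classes, layers, up-sets, random;
  h ≤ 9, 0 bad) — so the all-u stubs STAY registered (alive, stronger); the Lower forms are where an inductive proof along the peel would land.
  Registered open stubs after v6: `stub_universalJoinWide`, `stub_qjoinSharp`, `stub_fit`, `stub_afit`, `stub_afitLower`, `stub_pairJoinWideLower` (6 of ≤ 7).
* **v7 (2026-08-28T04:41Z, planner p1 g20): the MAJORITY NODE (val-np-p6 g9, p605313 `…HiddenStatesMajorityNode.lean` ACCEPTED) — SEVENTH and LAST stub;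
  THE REGISTRY IS FULL (7/7).** `stub_majorityJoinWideLower` (verbatim `LowerNode.Stmt.majorityJoinWideLower`, over the structure `LowerNode.WideDesign h r`
  = a legal wide design with its legality proofs bundled, and `WideDesign.Good`): for all large h and r ≤ 2^h a FINITE LIST of legal wide designs such
  that every injective LOWER row family is good for MORE THAN HALF of the list ⇒ (pigeonhole, `LowerNode.pairJoinWideLower_of_majority`) the pair node ⇒
  the crux. The PROBABILISTIC-METHOD architecture suggested by p6 g9's MAJORITY-GOOD census (907 lower families × ≈ 40 random comparable-weight legal
  designs at h = 8, 9: ZERO bad designs). Registered open stubs after v7: `stub_universalJoinWide`, `stub_qjoinSharp`, `stub_fit`, `stub_afit`,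
  `stub_afitLower`, `stub_pairJoinWideLower`, `stub_majorityJoinWideLower`.
* **v8 (2026-08-28T10:40Z, planner p1 g21 — ONE EXCHANGE with val-np-p3 g11, who LANDED the typed uniform-menu nodes p623583 `…UniformMenu.lean` at 10:15Z):
  LOSSLESS MERGER `stub_fit` → `stub_afit` + the EXACT-SUPPORT PAIR NODE.** `theorem stub_fit` (sorried) LEAVES the registry: `Fit ⊆ AFit` is in the kernel (`stub_afit_of_fit`, p593109), so a proof of F⁺
  (`SymbJoin.Stmt.fitConjecture`) still lands the registered `stub_afit` by a one-liner and closes the crux (`PartitionMinorsHitByVP_of_fit` stays). The freed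
  slot goes to `stub_simplexPairLower` = verbatim the body of val-np-p3 g11's typed node `SimplexJoin.Stmt.simplexPairLower` (p610840
  `Theorems/BarrierLeverPartitionMinorsHitByVPSimplexJoinNodes.lean`): for all large `h` and every PAIR of injective LOWER families ONE simplex-product design
  (`m ≤ (2h)²` pieces, depth `D ≤ 2h`, width `N ≤ (2h)²`, exact live enumeration — NO weights, NO threshold legality; both Cauchy–Binet factors SQUARE) good on
  both sides; composition `PartitionMinorsHitByVP_of_simplexPairLower` through the landed `SimplexJoin.partitionMinorsHitByVP_of_simplexPairLower` (b = 14).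
  STRONGER NODES OF THE SAME LANE ARE CREDITED BY NAME, WITHOUT A SLOT: `SimplexJoin.Stmt.simplexUniversal` (p610840) through
  `stub_simplexPairLower_of_simplexUniversal` below; and ONE LEVEL ABOVE IT val-np-p3 g11's UNIFORM-PIECES REDUCTION (p621024
  `Theorems/BarrierLeverPartitionMinorsHitByVPSimplexJoinUniform.lean`: `good_of_uniform_pieces` — pieces good on EVERY injective row family of their size ⇒
  the design is good on every injective `u`, by iterated row-threshold absorption along binary weights; `partitionMinor_hit_of_uniformPieces`, b = 10; p621310
  `uniform_of_singleSlot`: simplex pieces are uniform): 19717 ⇐ (UM) «(T+P)-clean product pieces are uniform» ∧ (ARITH) «every r ≤ 2^h is a sum of sizes of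
  clean pieces within the bounds» — TYPED by p3 as `SimplexJoin.Stmt.uniformMenuSimplex` / `Stmt.uniformMenuWide` (p623583 `…UniformMenu.lean`, with the arrows
  `simplexUniversal_of_uniformMenuSimplex`, `partitionMinorsHitByVP_of_uniformMenuSimplex` (b = 10), `universalJoinWide_of_uniformMenuWide` (b = 8)); the kernel
  credits `stub_simplexPairLower_of_uniformMenuSimplex` and `stub_universalJoinWide_of_uniformMenuWide` below make a proof of either uniform-menu node (= UM ∧ ARITH
  for that door) close a REGISTERED stub BY NAME. Conjecture CB (complete balls, K = h) is REFUTED in the kernel (p624333 `not_completeBallsUniversal`, h = K = 33) —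
  no registered stub asserted it.
  Registered open stubs after v8: `stub_universalJoinWide`, `stub_qjoinSharp`, `stub_afit`, `stub_afitLower`, `stub_pairJoinWideLower`,
  `stub_majorityJoinWideLower`, `stub_simplexPairLower` (7/7).
* **v9 (2026-08-28T22:45Z, planner p1 g23 — RULING R20 of planner p1 g22, HOME/STATUS.md l.1518, executed on the landing of val-np-p3 g16's part 2,
  p672719 `Theorems/BarrierLeverPartitionMinorsHitByVPHiddenStatesFullJoin.lean` ACCEPTED 22:09Z): WEAKEST-NODE SWAP `stub_pairJoinWideLower` ↦ `stub_fullJoinPairLower` (1:1).**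
  `theorem stub_pairJoinWideLower` (sorried) LEAVES the registry; its `def` stays, and the kernel arrow `stub_fullJoinPairLower_of_pairJoinWideLower` (p672719
  `FullJoin.fullJoinPairLower_of_pairJoinWideLower`: with κ_p = t₀^{W p}, λ_{pk} = t₀^{wt p k} a legal wide threshold design good on both sides is the t₀-leading coefficient
  of the full sum) makes a proof of the old text land the new registered stub by a one-liner. `stub_fullJoinPairLower` = verbatim the body of `FullJoin.Stmt.fullJoinPairLower`
  (p672719; `stub_fullJoinPairLower_iff := Iff.rfl`): for all large `h` and every PAIR of injective LOWER families of `r` subsets of `Fin h`, SOME wide FULL join (`m ≤ 2h` pieces,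
  `K ≤ h³` states, per-piece tables, piece weights `κ`, state weights `λ`; ALL `2^K` state sets of every piece — NO threshold family, NO column selection) has a nonsingular
  block-additive sum. THE WEAKEST typed hypothesis of the line (implied by every registered stub through the pair node: `stub_fullJoinPairLower_of_afitLower`, `_of_majority`,
  `_of_universalJoinWide` below) and it closes the crux through val-np-p3 g16's FULL-JOIN DOOR (p672458 `FullJoin.partitionMinor_hit_of_fullJoin_mem`, `b = 8` on lower pairs,
  + `DownCompression.partitionMinorsHitByVP_of_lowerSets` ⇒ `b = 12`): `PartitionMinorsHitByVP_of_fullJoinPairLower` (ninth composition, kernel-checked).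
  CONJECTURE FJ = `FullJoin.Stmt.fullJoinCubePairLower` (ONE cube, `K ≤ h` states, generic state weights `λ`, no column selection; val-np-p3 g16 census, memo
  HOME/val-np-p3/g16/MEMO-fulljoin-valnp3-g16.md, kit j318982–6/j319098: lower pairs `h ≤ 5` EXHAUSTIVE (class pairs with independent tables; all 84 315 class×down-set pairs with a
  shared table), `h = 6..10`: 4 000 / 23 000 / 1 500 / 400 / 120 size-targeted adversarial/random pairs — ZERO singular; `λ ≡ 1` singular at `h = 3` (square vs star) ⇒ the weights
  are load-bearing; H1 «a COMMON good separable S per pair» = the old pair node with `m = 1`, `K = h`: all pairs `h ≤ 5`, 200/200 at `h = 6`) is STRONGER/incomparable and CREDITED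
  BY NAME without a slot (`stub_fullJoinPairLower_of_fullJoinCube`, `PartitionMinorsHitByVP_of_fullJoinCube`); a slot only on a nominated expiry (candidate of record:
  `stub_majorityJoinWideLower`). Composition of record unchanged (`PartitionMinorsHitByVP_of : Stmt.stub_universalJoinWide → PartitionMinorsHitByVP`).
  Registered open stubs after v9: `stub_universalJoinWide`, `stub_qjoinSharp`, `stub_afit`, `stub_afitLower`, `stub_fullJoinPairLower`,
  `stub_majorityJoinWideLower`, `stub_simplexPairLower` (7/7).

CHEAPEST FALSIFIER / CENSUS RULE (val-np-p6 lineage owns the census, val-np-p3 the constructions): a lower family `u`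
(w.l.o.g. a simplicial complex, val-np-p1 g12 reduction) defeating EVERY join family with pieces `K ≤ h²` — exact linear
algebra with two independent generic tables (mod-p + rational reconstruction), organised by projection profile
(h' = #coordinates used, face sizes), straddling and concentrated lower sets first (the profiles that killed K ≤ 2h).
One such family at any h kills `stub_qjoinSharp`; a family defeating the single ball–colex cube for every `K ≤ h³` kills
`stub_qstarCube`; `stub_universalJoinWide` dies only if both do for all `m ≤ 2h`.

Planner valiant-natproofs-p1 g19 (D-0145 line-first rule; director-valiant g8 19:44:03Z). bears_on: V4 (𝒟-side line for
item 19717; nothing on 14610 / VP ≠ VNP).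
-/

/-! ## REGISTRY v10 (planner valiant-natproofs-p1 g24, 2026-08-29T11:39Z; RULING R45, STATUS l.1804; trigger = p715828
`Theorems/BarrierLeverPartitionMinorsHitByVPHiddenStatesGadgetNode.lean`, val-np-p3 g20)

WEAKEST-NODE SWAP OF NODE #1: `stub_universalJoinWide` (ONE universal wide THRESHOLD-join family per `(h, r)`) ↦
**`stub_gadgetUniversal`** (GU = `GadgetDoor.Stmt.gadgetUniversal` VERBATIM: ONE universal GADGET design per `(h, r)` —
`m ≤ 2h` pieces × `t ≤ h³` slots × `s` options with `t·s ≤ 4h³`, option = a state set over pairwise disjoint blocks, additive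
costs, strict threshold separation of the used (piece, option-choice) cells — whose x-slot matrix is nonsingular for EVERY
injective row family). GU is WEAKER than the old node (a threshold join = a gadget design with trivial blocks `∅/{k}` and
costs `0/wt`: `GadgetDoor.gadgetUniversal_of_universalJoinWide`, kernel) and CLOSES THE ITEM through the landed gadget door
(`GadgetDoor.partitionMinorsHitByVP_of_gadgetUniversal`, p715369 + p715828; `b = 8`, `h₀ = max h₁ 3`). Composition of record:
`PartitionMinorsHitByVP_of : Stmt.stub_gadgetUniversal → PartitionMinorsHitByVP`. The old node stays BY NAME
(`Stmt.stub_universalJoinWide`, arrow `stub_gadgetUniversal_of_universalJoinWide`; its v1 door composition is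
`PartitionMinorsHitByVP_of_universalJoinWide`, concluding `ItemByName`). BY-NAME DEVICES INTO GU (val-np-p3 g20): the GREEDY
PIECE CUT (p712723 `GreedyCut.exists_rowScale_det_ne_zero_of_bases`), the TRIPLE LEMMA (p713935 `PairBlock.exists_table_triple`),
THEOREM M (p715486 `Matching.exists_table_of_isMatching`, in review at v10), the BP(t, b, D) block-peeling programme (memo
MEMO-blockpeeling-valnp3-g20.md §7). `Stmt.stub_qstarCube` (Q*(h³)) is a SETTLED NEGATIVE EDGE (`not_stub_qstarCube`, p577137) and is
hereby STRUCK from the narrative as «conjecture of record» (R45); the text stays only as the refuted decl. AUDIT SHAPE (v10): theorems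
whose hypotheses are not registered sorried stubs conclude `ItemByName` (`_of_universalJoinWide`, `_of_fit`, `_of_pairJoinWideLower`,
`_of_fullJoinCube`). Registered open stubs after v10 (7 = ceiling): `stub_gadgetUniversal` (#1), `stub_qjoinSharp`, `stub_afit`,
`stub_afitLower`, `stub_fullJoinPairLower`, `stub_majorityJoinWideLower`, `stub_simplexPairLower`. REFUTER TARGETS OF RECORD (design
column): a family ℛ ⊆ 2^[h], |ℛ| > h + C(b,2) + b, with {g_i, g_i + g_j} dependent (falsifies BP(2, b, ·)); a down-set with K ≥ h and
M(K, Δ) singular for every table (falsifies Mˢ); a lower family defeating EVERY gadget design within the budget (falsifies GU itself).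
-/

set_option linter.dupNamespace false

namespace Summit.ValiantsHypothesis.ValiantsHypothesis.Cruxes.PartitionMinorsHitByVP.HiddenStates

open Finset
open Literature.Barriers.ValiantsHypothesis (SmallCircuits)
open Summit.ValiantsHypothesis.ValiantsHypothesis.Theorems.BarrierLever.HiddenStates
  (BallGood ballWt exists_ballColex partitionMinorsHitByVP_of_ballGood_cube
   SymbJoin.Fit SymbJoin.Stmt.fitConjecture SymbJoin.universalJoinWide_of_fitConjecture
   SymbJoin.AFit SymbJoin.Stmt.afitConjecture SymbJoin.universalJoinWide_of_afitConjecture SymbJoin.afitConjecture_of_fitConjecture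
   LowerNode.Stmt.afitLower LowerNode.Stmt.pairJoinWideLower LowerNode.Stmt.universalJoinWideLower
   LowerNode.afitLower_of_afitConjecture LowerNode.universalJoinWideLower_of_afitLower LowerNode.pairJoinWideLower_of_universalJoinWideLower
   LowerNode.universalJoinWideLower_of_universalJoinWide LowerNode.partitionMinorsHitByVP_of_afitLower LowerNode.partitionMinorsHitByVP_of_pairJoinWideLower
   LowerNode.WideDesign LowerNode.Stmt.majorityJoinWideLower LowerNode.pairJoinWideLower_of_majority LowerNode.partitionMinorsHitByVP_of_majority
   LowerNode.majority_of_universalJoinWideLower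
   FullJoin.Stmt.fullJoinPairLower FullJoin.Stmt.fullJoinCubePairLower FullJoin.fullJoinPairLower_of_pairJoinWideLower FullJoin.fullJoinPairLower_of_cube
   FullJoin.partitionMinorsHitByVP_of_fullJoinPairLower FullJoin.partitionMinorsHitByVP_of_fullJoinCubePairLower)
open Summit.ValiantsHypothesis.ValiantsHypothesis.Theorems.BarrierLever.SimplexJoin
  (Stmt.simplexPairLower Stmt.simplexUniversal simplexPairLower_of_simplexUniversal partitionMinorsHitByVP_of_simplexPairLower
   Stmt.uniformMenuWide Stmt.uniformMenuSimplex universalJoinWide_of_uniformMenuWide simplexUniversal_of_uniformMenuSimplex)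
open Summit.ValiantsHypothesis.ValiantsHypothesis.Theses.BarrierLever (PartitionMinorsHitByVP)

/-- The item, by name (audit alias: compositions whose hypotheses are not registered stubs conclude this). -/
abbrev ItemByName : Prop := PartitionMinorsHitByVP

theorem itemByName_iff : ItemByName ↔ PartitionMinorsHitByVP := Iff.rfl

/-! ## The statements of the line (named, so that the composition's type is literally `S₁ → S₂ → crux`) -/

/-- THE WIDE JOIN DOOR (statement): join witnesses with `m ≤ 2h` pieces of `K ≤ h³` hidden states each hit a layout
inside `SmallCircuits ℂ (h+h) 8` as soon as both block-additive matrices are nonsingular (`h ≥ 3`). -/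
def Stmt.stub_joinDoorWide : Prop :=
  ∀ (h m K r : ℕ), 3 ≤ h → m ≤ h + h → K ≤ h * h * h →
    ∀ (u w : Fin r → Finset (Fin h)) (e : Fin r → Fin m × Finset (Fin K)), Function.Injective e →
      ∀ (W : Fin m → ℕ) (wt : Fin m → Fin K → ℕ),
        (∀ x : Fin m × Finset (Fin K), x ∉ Set.range e →
          ∀ i, W (e i).1 + ∑ k ∈ (e i).2, wt (e i).1 k < W x.1 + ∑ k ∈ x.2, wt x.1 k) →
        ∀ (tx ty : Fin m → Option (Fin K) → Fin h → ℂ),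
          (Matrix.of fun i k : Fin r =>
            ∏ a ∈ u i, (tx (e k).1 none a + ∑ q ∈ (e k).2, tx (e k).1 (some q) a)).det ≠ 0 →
          (Matrix.of fun j k : Fin r =>
            ∏ c ∈ w j, (ty (e k).1 none c + ∑ q ∈ (e k).2, ty (e k).1 (some q) c)).det ≠ 0 →
          ∃ f ∈ SmallCircuits ℂ (h + h) 8,
            (Matrix.of fun i j : Fin r => MvPolynomial.coeff
              (∑ a ∈ u i, Finsupp.single (Fin.castAdd h a) 1 +
                ∑ c ∈ w j, Finsupp.single (Fin.natAdd h c) 1) f).det ≠ 0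

/-- THE CONJECTURE NODE (statement): ONE universal wide join family per `(h, r)`. -/
def Stmt.stub_universalJoinWide : Prop :=
  ∃ h₁ : ℕ, ∀ h : ℕ, h₁ ≤ h → ∀ r : ℕ, r ≤ 2 ^ h →
    ∃ (m K : ℕ) (W : Fin m → ℕ) (wt : Fin m → Fin K → ℕ) (e : Fin r → Fin m × Finset (Fin K)),
      m ≤ h + h ∧ K ≤ h * h * h ∧ Function.Injective e ∧
      (∀ x : Fin m × Finset (Fin K), x ∉ Set.range e →
        ∀ i, W (e i).1 + ∑ k ∈ (e i).2, wt (e i).1 k < W x.1 + ∑ k ∈ x.2, wt x.1 k) ∧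
      ∀ u : Fin r → Finset (Fin h), Function.Injective u →
        ∃ tx : Fin m → Option (Fin K) → Fin h → ℂ,
          (Matrix.of fun i k : Fin r =>
            ∏ a ∈ u i, (tx (e k).1 none a + ∑ q ∈ (e k).2, tx (e k).1 (some q) a)).det ≠ 0


/-- **NODE #1 (v10, RULING R45): GADGET-UNIVERSAL (GU)** — VERBATIM `GadgetDoor.Stmt.gadgetUniversal`
(p715828 `…HiddenStatesGadgetNode`): ONE universal gadget design per `(h, r)`, nonsingular x-slot matrix for EVERY injective row family. -/
def Stmt.stub_gadgetUniversal : Prop :=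
  ∃ h₁ : ℕ, ∀ h : ℕ, h₁ ≤ h → ∀ r : ℕ, r ≤ 2 ^ h →
    ∃ (m t s K : ℕ) (D : Fin m → Fin t → Fin s → Finset (Fin K)) (W : Fin m → ℕ)
      (cost : Fin m → Fin t → Fin s → ℕ) (e : Fin r → Fin m × (Fin t → Fin s)),
      m ≤ h + h ∧ t ≤ h * h * h ∧ t * s ≤ 4 * (h * h * h) ∧ Function.Injective e ∧
      (∀ x : Fin m × (Fin t → Fin s), x ∉ Set.range e →
        ∀ k, W (e k).1 + ∑ l, cost (e k).1 l ((e k).2 l) < W x.1 + ∑ l, cost x.1 l (x.2 l)) ∧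
      (∀ k, (Set.univ : Set (Fin t)).PairwiseDisjoint fun l => D (e k).1 l ((e k).2 l)) ∧
      ∀ u : Fin r → Finset (Fin h), Function.Injective u →
        ∃ T : Fin m → Option (Fin K) → Fin h → ℂ,
          (Matrix.of fun i k : Fin r => ∏ a ∈ u i,
            (T (e k).1 none a + ∑ q ∈ (Finset.univ.biUnion fun l => D (e k).1 l ((e k).2 l)),
              T (e k).1 (some q) a)).det ≠ 0

theorem stub_gadgetUniversal_iff : Stmt.stub_gadgetUniversal ↔ Summit.ValiantsHypothesis.ValiantsHypothesis.Theorems.BarrierLever.HiddenStates.GadgetDoor.Stmt.gadgetUniversal := Iff.rfl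
/-- OPEN STUB (v4, 2026-08-28, val-np-p3 g10): THE FITTING CONJECTURE F⁺ — verbatim the body of `SymbJoin.Stmt.fitConjecture` of
`Theorems/BarrierLeverPartitionMinorsHitByVPHiddenStatesFit.lean` (p588547; `Fit` = the inductive fitting certificate: leaf = columns in pairwise
distinct pieces, node = one hyperplane split step `symGood_of_split_enum`). For all large `h` and every `r ≤ 2^h` ONE legal wide join threshold
family (`m ≤ 2h` pieces, `K ≤ h³` states) is `Fit`-certified against EVERY injective row family. A purely combinatorial sufficient form of the
conjecture node (no linear algebra over ℂ): `Fit u e ⇒ symDet u e ≠ 0 ⇒ ∃ table` (`Fit.exists_table`), hence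
`SymbJoin.universalJoinWide_of_fitConjecture : fitConjecture → (body of Stmt.stub_universalJoinWide)`. Census (p3 g10 memo §12–§14): the fully
peeled greedy-ball design is Fit-certified (ADAPTIVE coordinate order, cut menu |Q⁺| ≤ 2, |Q⁻| ≤ 1) on every tested family, h ≤ 11; fixed
orders are a 99 % heuristic only. CHEAPEST FALSIFIER: a lower family at h ≤ 10 with no Fit certificate for any legal wide design (DP lab/fitpeel.py). -/
def Stmt.stub_fit : Prop :=
  ∃ h₁ : ℕ, ∀ h : ℕ, h₁ ≤ h → ∀ r : ℕ, r ≤ 2 ^ h →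
    ∃ (m K : ℕ) (W : Fin m → ℕ) (wt : Fin m → Fin K → ℕ) (e : Fin r → Fin m × Finset (Fin K)),
      m ≤ h + h ∧ K ≤ h * h * h ∧ Function.Injective e ∧
      (∀ x : Fin m × Finset (Fin K), x ∉ Set.range e →
        ∀ i, W (e i).1 + ∑ k ∈ (e i).2, wt (e i).1 k < W x.1 + ∑ k ∈ x.2, wt x.1 k) ∧
      ∀ u : Fin r → Finset (Fin h), Function.Injective u → SymbJoin.Fit u e

/-- OPEN STUB (v5, 2026-08-28, planner p1 g20 for val-np-p6 g8): THE COMBINATORIAL FITTING CONJECTURE AF⁺ — verbatim the body of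
`SymbJoin.Stmt.afitConjecture` of `Theorems/BarrierLeverPartitionMinorsHitByVPHiddenStatesAFit.lean` (p593109; `AFit` = the inductive certificate with
affinely-closed split nodes and affinely-free (or `Fit`) leaves; `AFit.symDet_ne_zero`, `AFit.exists_table`). For all large `h` and every `r ≤ 2^h` ONE
legal wide join threshold family (`m ≤ 2h` pieces, `K ≤ h³` states) is `AFit`-certified against EVERY injective row family. WEAKER than `Stmt.stub_fit`
(`AFit ⊇ Fit`; `stub_afit_of_fit`) and constant-free: certifiability is the pure combinatorial cut-tree game of p6 g8 (exact zero sets = affinely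
closed sub-families). WHY IT MIGHT FAIL: `AFit` is INCOMPLETE (good configurations without any cut-tree certificate exist: h = 4 hub star vs
B₁([4]) ∪ {01,02,12}; h = 6 bare B₂(6) at two profiles, kit j295398) — a down-set on which every legal wide design is uncertifiable kills the stub
but not the node. CHEAPEST FALSIFIER: kit/cuttree Solver2 (general affinely-closed cuts, adaptive order) on all down-sets h ≤ 10 against the
fully-peeled design (j296060), then the ball game h ≤ 12 (j296275). SOURCES: p593109, p591478, p591757, p589275; memo HOME/val-np-p6/g8/MEMO-cuttree-valnp6-g8.md. -/
def Stmt.stub_afit : Prop :=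
  ∃ h₁ : ℕ, ∀ h : ℕ, h₁ ≤ h → ∀ r : ℕ, r ≤ 2 ^ h →
    ∃ (m K : ℕ) (W : Fin m → ℕ) (wt : Fin m → Fin K → ℕ) (e : Fin r → Fin m × Finset (Fin K)),
      m ≤ h + h ∧ K ≤ h * h * h ∧ Function.Injective e ∧
      (∀ x : Fin m × Finset (Fin K), x ∉ Set.range e →
        ∀ i, W (e i).1 + ∑ k ∈ (e i).2, wt (e i).1 k < W x.1 + ∑ k ∈ x.2, wt x.1 k) ∧
      ∀ u : Fin r → Finset (Fin h), Function.Injective u → SymbJoin.AFit u e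

/-- OPEN STUB (v6, 2026-08-28, planner p1 g20 for val-np-p6 g9): **AF⁺ RESTRICTED TO DOWN-SETS** — verbatim the body of
`LowerNode.Stmt.afitLower` (p599518 `Theorems/BarrierLeverPartitionMinorsHitByVPHiddenStatesLowerNode.lean`): as `Stmt.stub_afit` but the row family `u`
ranges over injective families with LOWER-SET range only. This is the form every census tested (F⁺-PEEL / AF⁺ / WBALL-LADDER are down-set statements) and the
form an induction along the peel (link ⊆ deletion) would prove; it still closes the crux because lower pairs suffice (`DownCompression.partitionMinorsHitByVP_of_lowerSets`).
WHY IT MIGHT FAIL: as for `stub_afit` — AFit-incompleteness on some down-set for EVERY legal wide design (exact incompleteness witnesses exist for under-peeled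
designs: h = 4 hub stars, (6,22), (6,23), (7,30); none for the full peel). SOURCES: p599518, p593109; memos HOME/val-np-p6/g8, g9. -/
def Stmt.stub_afitLower : Prop :=
  ∃ h₁ : ℕ, ∀ h : ℕ, h₁ ≤ h → ∀ r : ℕ, r ≤ 2 ^ h →
    ∃ (m K : ℕ) (W : Fin m → ℕ) (wt : Fin m → Fin K → ℕ) (e : Fin r → Fin m × Finset (Fin K)),
      m ≤ h + h ∧ K ≤ h * h * h ∧ Function.Injective e ∧
      (∀ x : Fin m × Finset (Fin K), x ∉ Set.range e →
        ∀ i, W (e i).1 + ∑ k ∈ (e i).2, wt (e i).1 k < W x.1 + ∑ k ∈ x.2, wt x.1 k) ∧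
      ∀ u : Fin r → Finset (Fin h), Function.Injective u → IsLowerSet (Set.range u) → SymbJoin.AFit u e

/-- OPEN STUB (v6, 2026-08-28, planner p1 g20 for val-np-p6 g9): **THE PAIR NODE RESTRICTED TO LOWER SETS** — verbatim the body of
`LowerNode.Stmt.pairJoinWideLower` (p599518): the WEAKEST hypothesis the wide join door accepts — for all large `h` and every PAIR `(u, w)` of injective
families of `r ≤ 2^h` subsets of `Fin h` with lower-set ranges there is ONE legal wide threshold design `e` (m ≤ 2h pieces, K ≤ h³ states; it may depend
on the pair) that is GOOD on the `u`-side and on the `w`-side (a substitution making each side's design minor nonsingular). Implied by every other stub of the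
line (`pairJoinWideLower_of_universalJoinWideLower ∘ …`); composition `LowerNode.partitionMinorsHitByVP_of_pairJoinWideLower` (b = 12). This is the statement
the census engines certify instance by instance. WHY IT MIGHT FAIL: a lower pair on which EVERY legal wide design is bad on one side (none known; the
count of legal designs is finite per (h, r), so small h is exhaustible). SOURCES: p599518, p575468 (wide join door). -/
def Stmt.stub_pairJoinWideLower : Prop :=
  ∃ h₁ : ℕ, ∀ h : ℕ, h₁ ≤ h → ∀ (r : ℕ) (u w : Fin r → Finset (Fin h)),
    Function.Injective u → Function.Injective w → IsLowerSet (Set.range u) → IsLowerSet (Set.range w) →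
    ∃ (m K : ℕ) (W : Fin m → ℕ) (wt : Fin m → Fin K → ℕ) (e : Fin r → Fin m × Finset (Fin K)),
      m ≤ h + h ∧ K ≤ h * h * h ∧ Function.Injective e ∧
      (∀ x : Fin m × Finset (Fin K), x ∉ Set.range e →
        ∀ i, W (e i).1 + ∑ k ∈ (e i).2, wt (e i).1 k < W x.1 + ∑ k ∈ x.2, wt x.1 k) ∧
      (∃ tx : Fin m → Option (Fin K) → Fin h → ℂ,
        (Matrix.of fun i k : Fin r =>
          ∏ a ∈ u i, (tx (e k).1 none a + ∑ q ∈ (e k).2, tx (e k).1 (some q) a)).det ≠ 0) ∧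
      (∃ ty : Fin m → Option (Fin K) → Fin h → ℂ,
        (Matrix.of fun j k : Fin r =>
          ∏ c ∈ w j, (ty (e k).1 none c + ∑ q ∈ (e k).2, ty (e k).1 (some q) c)).det ≠ 0)

/-- OPEN STUB (v9, 2026-08-28, planner p1 g23 for val-np-p3 g16 — R20): **THE FULL-JOIN PAIR NODE ON LOWER SETS** — verbatim the body of
`FullJoin.Stmt.fullJoinPairLower` (p672719 `Theorems/BarrierLeverPartitionMinorsHitByVPHiddenStatesFullJoin.lean`): for all large `h` and every PAIR `(u, w)` of
injective LOWER families of `r` subsets of `Fin h` there are `m ≤ 2h` pieces of `K ≤ h³` hidden states, per-piece tables `tx, ty`, piece weights `κ` and state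
weights `λ` for which the FULL block-additive sum (ALL `2^K` state sets of every piece; NO threshold family, NO column selection) is a nonsingular `r × r` matrix.
THE WEAKEST typed hypothesis of the line: implied by the old pair node (`stub_fullJoinPairLower_of_pairJoinWideLower`, the `t₀`-leading-coefficient argument of
p672719), hence by every registered stub; composition `PartitionMinorsHitByVP_of_fullJoinPairLower` through the FULL-JOIN DOOR (p672458, `b = 8` on lower pairs)
+ down-compression (`b = 12`). WHY IT MIGHT FAIL: a lower pair on which `det` of the full sum — a polynomial in `(κ, λ, tables)` — vanishes identically for every
`m ≤ 2h`, `K ≤ h³` (none known: the one-cube `K = h` instance FJ has ZERO singular pairs for `h ≤ 5` exhaustive and `h = 6..10` sampled; only the weight-free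
variant `λ ≡ 1` dies, at `h = 3`, square vs star). CHEAPEST FALSIFIER: a lower pair with the ONE-cube full hidden sum identically singular (mod-p numerics with two
tables, then symbolic confirmation), escalated to `m = 2h`, `K = h³`. SOURCES: p672719, p672458, p599518; memo HOME/val-np-p3/g16/MEMO-fulljoin-valnp3-g16.md. -/
def Stmt.stub_fullJoinPairLower : Prop :=
  ∃ h₁ : ℕ, ∀ h : ℕ, h₁ ≤ h → ∀ (r : ℕ) (u w : Fin r → Finset (Fin h)),
    Function.Injective u → Function.Injective w → IsLowerSet (Set.range u) → IsLowerSet (Set.range w) →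
    ∃ (m K : ℕ) (tx ty : Fin m → Option (Fin K) → Fin h → ℂ) (kap : Fin m → ℂ) (lam : Fin m → Fin K → ℂ),
      m ≤ h + h ∧ K ≤ h * h * h ∧
      (Matrix.of fun i j : Fin r => ∑ p : Fin m, ∑ J : Finset (Fin K), kap p * (∏ k ∈ J, lam p k) *
        ((∏ a ∈ u i, (tx p none a + ∑ q ∈ J, tx p (some q) a)) *
          ∏ c ∈ w j, (ty p none c + ∑ q ∈ J, ty p (some q) c))).det ≠ 0

/-- OPEN STUB (v7, 2026-08-28, planner p1 g20 for val-np-p6 g9): **THE MAJORITY NODE** — verbatim the body of `LowerNode.Stmt.majorityJoinWideLower`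
(p605313 `Theorems/BarrierLeverPartitionMinorsHitByVPHiddenStatesMajorityNode.lean`; `LowerNode.WideDesign h r` bundles a legal wide threshold design
(m ≤ 2h pieces, K ≤ h³ states, injective columns, strict threshold legality) and `WideDesign.Good D u` says the u-side design minor is nonsingular for
some substitution): for all large `h` and every `r ≤ 2^h` there is a FINITE LIST of legal wide designs such that EVERY injective LOWER row family of size
`r` is good for MORE THAN HALF of the list. Two majorities intersect, so every lower PAIR has a common good design: `pairJoinWideLower_of_majority`, hence the
crux (`partitionMinorsHitByVP_of_majority`). WHY EASIER than the universal node: it is a PROBABILISTIC-METHOD statement about ONE row family at a time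
(«a random legal design is good for a fixed lower u with probability > 1/2»), and goodness of a fixed design is monotone under adding free points
(p603992 `symGood_addRow_free`). WHY IT MIGHT FAIL: a lower u that defeats at least half of EVERY finite list — i.e. (by LP duality) a probability
distribution on lower families against which every single legal design is bad with probability ≥ 1/2; none in sight (MAJORITY-GOOD census: 907 families ×
≈ 40 random designs at h = 8, 9, ZERO bad designs). SOURCES: p605313, p599518, p603992; memo HOME/val-np-p6/g9/MEMO-valnp6-g9.md, PROBLEM-CutGame-valnp6-g9.md. -/
def Stmt.stub_majorityJoinWideLower : Prop :=
  ∃ h₁ : ℕ, ∀ h : ℕ, h₁ ≤ h → ∀ r : ℕ, r ≤ 2 ^ h →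
    ∃ (M : ℕ) (D : Fin M → LowerNode.WideDesign h r), 0 < M ∧
      ∀ u : Fin r → Finset (Fin h), Function.Injective u → IsLowerSet (Set.range u) →
        ∃ S : Finset (Fin M), (∀ i ∈ S, (D i).Good u) ∧ M < 2 * S.card

/-- OPEN STUB (v8 DRAFT, planner p1 g21 for val-np-p3 g11): **THE EXACT-SUPPORT (SIMPLEX-PRODUCT) PAIR NODE ON LOWER SETS** — verbatim the body of
`SimplexJoin.Stmt.simplexPairLower` (p610840 `Theorems/BarrierLeverPartitionMinorsHitByVPSimplexJoinNodes.lean`): for all large `h` and every pair `(u, w)` of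
injective LOWER families of `r` subsets of `Fin h` there is ONE simplex-product design (`m ≤ (2h)²` pieces, depth `D ≤ 2h`, width `N ≤ (2h)²`, live sets `S`,
exact enumeration `e` of the live columns) that is GOOD on the `u`-side and on the `w`-side. No weights, no threshold legality (the live columns are EXACTLY a
product of simplices, so both Cauchy–Binet factors are square: `SimplexJoin.partitionMinor_hit_of_simplexJoin_mem_wide`). WHY IT MIGHT FAIL: the base-(h+1)
digit join is NOT universal (affine-dependence obstruction (O2), kit j300341: first failure h = 9, r = 100); a lower pair on which every simplex-product design
of the budget is bad on one side kills the stub (none known; candidates of record: depth ≈ D_min/2 with factors of ≈ h² vertices, or decaying factor sizes).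
SOURCES: p609944, p610558, p610840, p611971, p613126; memo HOME/val-np-p3/g11/. -/
def Stmt.stub_simplexPairLower : Prop :=
  ∃ h₁ : ℕ, ∀ h : ℕ, h₁ ≤ h → ∀ (r : ℕ) (u w : Fin r → Finset (Fin h)),
    Function.Injective u → Function.Injective w → IsLowerSet (Set.range u) → IsLowerSet (Set.range w) →
    ∃ (m D N : ℕ) (S : Fin m → Fin D → Finset (Fin N)) (e : Fin r → Fin m × (Fin D → Option (Fin N))),
      m ≤ (h + h) ^ 2 ∧ D ≤ h + h ∧ N ≤ (h + h) ^ 2 ∧ Function.Injective e ∧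
      (∀ c : Fin m × (Fin D → Option (Fin N)),
        c ∈ Set.range e ↔ ∀ (f : Fin D) (j : Fin N), c.2 f = some j → j ∈ S c.1 f) ∧
      (∃ tx : Fin m → Option (Fin D × Fin N) → Fin h → ℂ,
        (Matrix.of fun i k : Fin r => ∏ a ∈ u i,
          (tx (e k).1 none a + ∑ f : Fin D, ((e k).2 f).elim 0 fun j => tx (e k).1 (some (f, j)) a)).det ≠ 0) ∧
      (∃ ty : Fin m → Option (Fin D × Fin N) → Fin h → ℂ,
        (Matrix.of fun i k : Fin r => ∏ c ∈ w i,
          (ty (e k).1 none c + ∑ f : Fin D, ((e k).2 f).elim 0 fun j => ty (e k).1 (some (f, j)) c)).det ≠ 0)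

/-- Q\*(h³) (statement) — the conjecture OF RECORD: the hypothesis of `partitionMinorsHitByVP_of_ballGood_cube`. -/
def Stmt.stub_qstarCube : Prop :=
  ∃ (h₁ : ℕ) (Kf : ℕ → ℕ), (∀ h : ℕ, h₁ ≤ h → h ≤ Kf h ∧ Kf h ≤ h * h * h) ∧
    ∀ h : ℕ, h₁ ≤ h → ∀ (r : ℕ) (u : Fin r → Finset (Fin h)), Function.Injective u → BallGood h (Kf h) r u

/-- Q_join(h²) (statement) — the SHARP killable variant: a universal join family whose pieces carry exactly `h·h` states. -/
def Stmt.stub_qjoinSharp : Prop :=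
  ∃ h₁ : ℕ, ∀ h : ℕ, h₁ ≤ h → ∀ r : ℕ, r ≤ 2 ^ h →
    ∃ (m : ℕ) (W : Fin m → ℕ) (wt : Fin m → Fin (h * h) → ℕ) (e : Fin r → Fin m × Finset (Fin (h * h))),
      m ≤ h + h ∧ Function.Injective e ∧
      (∀ x : Fin m × Finset (Fin (h * h)), x ∉ Set.range e →
        ∀ i, W (e i).1 + ∑ k ∈ (e i).2, wt (e i).1 k < W x.1 + ∑ k ∈ x.2, wt x.1 k) ∧
      ∀ u : Fin r → Finset (Fin h), Function.Injective u →
        ∃ tx : Fin m → Option (Fin (h * h)) → Fin h → ℂ,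
          (Matrix.of fun i k : Fin r =>
            ∏ a ∈ u i, (tx (e k).1 none a + ∑ q ∈ (e k).2, tx (e k).1 (some q) a)).det ≠ 0

/-! ## Registered stubs -/

/-- **Stub 1 — the wide join door.** Routine re-budgeting of `HiddenStates.partitionMinor_hit_of_hiddenJoin` (explicit size
`(h+h+2)²·(m(3(h+h) + K(3(h+h)+2) + K + 3) + m) + (h+h+1)`) for `m ≤ 2h`, `K ≤ h³`: `≤ 611 h⁷ ≤ (2h)⁸` for `h ≥ 3`.
Why plausibly true: it is arithmetic on a landed size bound. Size: M. Leans on: `partitionMinor_hit_of_hiddenJoin`. -/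
theorem stub_joinDoorWide : Stmt.stub_joinDoorWide := by
  -- LANDED: val-np-p3 g9, p569457 `Theorems/BarrierLeverPartitionMinorsHitByVPStubJoinDoorWide.lean` (2026-08-27T20:51Z).
  exact Summit.ValiantsHypothesis.ValiantsHypothesis.Theorems.BarrierLever.HiddenStatesLine.stub_joinDoorWide

/-- **Stub 2 — the conjecture node: a universal wide join family exists.** Implied by either of the two named forms
below (reductions proved in this file). Why it might fail: a lower family whose projection profile defeats every join
of ≤ 2h cubes of ≤ h³ states (none known; the census kills so far — concentration at K ≤ 2h, stars at K = h + O(1) —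
are size obstructions that vanish for K ≥ h²). Size: open (conjecture-grade). -/
theorem stub_gadgetUniversal : Stmt.stub_gadgetUniversal := by
  sorry

/-- v10 (R45): the former node #1 `Stmt.stub_universalJoinWide` is BY NAME — it implies the registered GU node
(p715828 `GadgetDoor.gadgetUniversal_of_universalJoinWide`: a threshold join is a gadget design with trivial blocks). -/
theorem stub_gadgetUniversal_of_universalJoinWide : Stmt.stub_universalJoinWide → Stmt.stub_gadgetUniversal :=
  fun H => Summit.ValiantsHypothesis.ValiantsHypothesis.Theorems.BarrierLever.HiddenStates.GadgetDoor.gadgetUniversal_of_universalJoinWide H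

/-- **Former stub 3 — Q\*(h³) — REFUTED IN THE KERNEL (val-np-p4 g15, p577137
`Theorems/BarrierLeverPartitionMinorsHitByVPHiddenStatesQstarCubeRefutation.lean`, 2026-08-27T22:09Z): `FiveRank.not_stub_qstarCube`
(the body of `Stmt.stub_qstarCube` verbatim, negated; engine `FiveRank.det_eq_zero_of_rows_le_five` + p3 g9's triple-rank/two-skeleton
range lemmas; witness: 5-uniform families, every `K ∈ [h, h⁴]`, `h ≥ 10¹⁰`). Together with `not_ballGood_hypothesis` (K = h) and
`not_ballGood_sq_hypothesis` / `not_ballGood_cube_below`, EVERY polynomial single-cube design is dead; the line rests on JOINS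
(`stub_universalJoinWide`, `stub_qjoinSharp`), which the (2e+1)-row starvation counts do not touch (p4's memo STUB-FALSE-qstarCube §«what
survives»: 2h pieces give ≥ 2h(h²+1) free singleton columns; Q_join(h²) has content only for `r > 2h³ + 2h`). No longer a registered stub. -/
theorem not_stub_qstarCube : ¬ Stmt.stub_qstarCube :=
  Summit.ValiantsHypothesis.ValiantsHypothesis.Theorems.BarrierLever.HiddenStates.FiveRank.not_stub_qstarCube

/-- **Stub 4 — Q_join(h²), the sharp killable variant** (director 19:25Z: pieces with `K ≥ h²` are concentration-immune by
counting). Why it might fail: joins add freedom only between pieces; inside a piece the family is still a cube down-set.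
Cheapest falsifier: ONE lower family at some h defeating every join with `K = h²` pieces (exact linear algebra, two tables). -/
theorem stub_qjoinSharp : Stmt.stub_qjoinSharp := by
  sorry

-- (was Stub 5 (v4) — the fitting conjecture F⁺, val-np-p3 g10; `Stmt.stub_fit` ≡ `SymbJoin.Stmt.fitConjecture`, p588547.)
-- EXPIRED (v8 DRAFT, planner p1 g21): `theorem stub_fit : Stmt.stub_fit` — MERGED into `stub_afit` (`Fit ⊆ AFit`, `stub_afit_of_fit` below); the def and
-- `PartitionMinorsHitByVP_of_fit` remain, so a proof of F⁺ (`SymbJoin.Stmt.fitConjecture`) still closes the crux and lands `stub_afit` by a one-liner.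

/-- **Stub 6 (v5) — the combinatorial fitting conjecture AF⁺** (val-np-p6 g8; `Stmt.stub_afit` ≡ `SymbJoin.Stmt.afitConjecture`, p593109).
Weaker than `stub_fit`; why it might fail: a down-set whose trie admits no cut tree with affinely-closed nodes for any legal wide design. -/
theorem stub_afit : Stmt.stub_afit := by
  sorry

/-- **Stub 7 (v6) — AF⁺ on down-sets** (val-np-p6 g9; `Stmt.stub_afitLower` ≡ `LowerNode.Stmt.afitLower`, p599518). -/
theorem stub_afitLower : Stmt.stub_afitLower := by
  sorry

-- (was Stub 8 (v6) — the pair node on lower sets, val-np-p6 g9; `Stmt.stub_pairJoinWideLower` ≡ `LowerNode.Stmt.pairJoinWideLower`, p599518.)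
-- EXPIRED (v9, planner p1 g23, RULING R20): `theorem stub_pairJoinWideLower : Stmt.stub_pairJoinWideLower` — SWAPPED 1:1 for the WEAKER full-join pair node
-- `stub_fullJoinPairLower` (old ⇒ new in the kernel: `stub_fullJoinPairLower_of_pairJoinWideLower` below, p672719); the def and
-- `PartitionMinorsHitByVP_of_pairJoinWideLower` remain, so a proof of the old pair node still closes the crux and lands `stub_fullJoinPairLower` by a one-liner.

/-- **Stub 11 (v9) — the full-join pair node on lower sets** (val-np-p3 g16; `Stmt.stub_fullJoinPairLower` ≡ `FullJoin.Stmt.fullJoinPairLower`, p672719).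
Why plausibly true: it is implied by every other registered stub, and its one-cube instance FJ has no singular lower pair in the whole census (h ≤ 10).
Why it might fail: identically-vanishing full-sum determinant on some lower pair for every wide budget. Size: open (conjecture-grade; the weakest node). -/
theorem stub_fullJoinPairLower : Stmt.stub_fullJoinPairLower := by
  sorry

/-- **Stub 9 (v7) — the majority node** (val-np-p6 g9; `Stmt.stub_majorityJoinWideLower` ≡ `LowerNode.Stmt.majorityJoinWideLower`, p605313). -/
theorem stub_majorityJoinWideLower : Stmt.stub_majorityJoinWideLower := by
  sorry

/-- **Stub 10 (v8 DRAFT) — the exact-support pair node on lower sets** (val-np-p3 g11; `Stmt.stub_simplexPairLower` ≡ `SimplexJoin.Stmt.simplexPairLower`, p610840). -/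
theorem stub_simplexPairLower : Stmt.stub_simplexPairLower := by
  sorry

/-! ## Reductions between the stubs (proved) -/

/-- Q_join(h²) ⇒ the conjecture node (`h·h ≤ h·h·h` for `h ≥ 1`). -/
theorem universalJoinWide_of_qjoinSharp : Stmt.stub_qjoinSharp → Stmt.stub_universalJoinWide := by
  rintro ⟨h₁, H⟩
  refine ⟨max h₁ 1, fun h hh r hr => ?_⟩
  have hh₁ : h₁ ≤ h := le_trans (le_max_left _ _) hh
  have h1 : 1 ≤ h := le_trans (le_max_right _ _) hh
  obtain ⟨m, W, wt, e, hm, he, hthr, Hu⟩ := H h hh₁ r hr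
  exact ⟨m, h * h, W, wt, e, hm, Nat.le_mul_of_pos_right _ (by omega), he, hthr, Hu⟩

/-- Q\*(h³) ⇒ the conjecture node (one piece: `m = 1`, `W = 0`, `wt = ballWt`, the ball–colex family). -/
theorem universalJoinWide_of_qstarCube : Stmt.stub_qstarCube → Stmt.stub_universalJoinWide := by
  rintro ⟨h₁, Kf, hK, H⟩
  refine ⟨max h₁ 1, fun h hh r hr => ?_⟩
  have hh₁ : h₁ ≤ h := le_trans (le_max_left _ _) hh
  have h1 : 1 ≤ h := le_trans (le_max_right _ _) hh
  obtain ⟨hKlo, hKhi⟩ := hK h hh₁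
  have hrK : r ≤ 2 ^ Kf h := hr.trans (Nat.pow_le_pow_right (by norm_num) hKlo)
  obtain ⟨e, he, hthr⟩ := exists_ballColex (Kf h) r hrK
  refine ⟨1, Kf h, fun _ => 0, fun _ k => ballWt (Kf h) k, fun i => ((0 : Fin 1), e i), by omega, hKhi, ?_, ?_, ?_⟩
  · intro i j hij
    exact he (congrArg Prod.snd hij)
  · intro x hx i
    have hx2 : x.2 ∉ Set.range e := by
      rintro ⟨j, hj⟩
      apply hx
      refine ⟨j, ?_⟩
      ext1
      · exact Subsingleton.elim _ _
      · exact hj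
    simpa using hthr x.2 hx2 i
  · intro u hu
    obtain ⟨tx, hx⟩ := H h hh₁ r u hu e he hthr
    exact ⟨fun _ => tx, by simpa using hx⟩

/-! ## Compositions (proved, no sorry) -/

/-- **THE ITEM FROM THE LINE (v10, composition of record): GU ⇒ `PartitionMinorsHitByVP`** through the landed gadget door
(p715828 `GadgetDoor.partitionMinorsHitByVP_of_gadgetUniversal`; `b = 8`). -/
theorem PartitionMinorsHitByVP_of : Stmt.stub_gadgetUniversal → PartitionMinorsHitByVP :=
  fun H => Summit.ValiantsHypothesis.ValiantsHypothesis.Theorems.BarrierLever.HiddenStates.GadgetDoor.partitionMinorsHitByVP_of_gadgetUniversal (stub_gadgetUniversal_iff.mp H)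

/-- The v1–v9 composition (wide join door + ONE universal wide join family ⇒ the item), now BY NAME through GU; concludes `ItemByName`
(its hypothesis is no longer a registered stub). -/
theorem PartitionMinorsHitByVP_of_universalJoinWide : Stmt.stub_universalJoinWide → ItemByName :=
  fun H => PartitionMinorsHitByVP_of (stub_gadgetUniversal_of_universalJoinWide H)

/-- The sharp variant closes the crux through the line. -/
theorem PartitionMinorsHitByVP_of_qjoinSharp : Stmt.stub_qjoinSharp → PartitionMinorsHitByVP :=
  fun hq => PartitionMinorsHitByVP_of_universalJoinWide (universalJoinWide_of_qjoinSharp hq)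

/-- `Stmt.stub_fit` is literally p3's typed conjecture. -/
theorem stub_fit_iff : Stmt.stub_fit ↔ SymbJoin.Stmt.fitConjecture := Iff.rfl

/-- **Third composition (v4, kernel-checked): the fitting conjecture closes the crux through the line** —
`Fit`-certificates give tables (`SymbJoin.universalJoinWide_of_fitConjecture`, p588547), i.e. the conjecture node, then `PartitionMinorsHitByVP_of`. -/
theorem PartitionMinorsHitByVP_of_fit : Stmt.stub_fit → ItemByName :=
  fun hF => PartitionMinorsHitByVP_of_universalJoinWide (SymbJoin.universalJoinWide_of_fitConjecture hF)

/-- `Stmt.stub_afit` is literally p6's typed conjecture. -/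
theorem stub_afit_iff : Stmt.stub_afit ↔ SymbJoin.Stmt.afitConjecture := Iff.rfl

/-- `AFit ⊇ Fit`: the v4 stub implies the v5 stub (p593109 `afitConjecture_of_fitConjecture`). -/
theorem stub_afit_of_fit : Stmt.stub_fit → Stmt.stub_afit :=
  fun hF => SymbJoin.afitConjecture_of_fitConjecture hF

/-- **Fourth composition (v5, kernel-checked): the combinatorial fitting conjecture closes the crux through the line** —
`AFit`-certificates give tables (`SymbJoin.universalJoinWide_of_afitConjecture`, p593109), i.e. the conjecture node, then `PartitionMinorsHitByVP_of`. -/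
theorem PartitionMinorsHitByVP_of_afit : Stmt.stub_afit → PartitionMinorsHitByVP :=
  fun hF => PartitionMinorsHitByVP_of_universalJoinWide (SymbJoin.universalJoinWide_of_afitConjecture hF)

theorem stub_afitLower_iff : Stmt.stub_afitLower ↔ LowerNode.Stmt.afitLower := Iff.rfl

theorem stub_pairJoinWideLower_iff : Stmt.stub_pairJoinWideLower ↔ LowerNode.Stmt.pairJoinWideLower := Iff.rfl

/-- all-u AF⁺ implies its down-set restriction (p599518). -/
theorem stub_afitLower_of_afit : Stmt.stub_afit → Stmt.stub_afitLower :=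
  fun H => LowerNode.afitLower_of_afitConjecture (stub_afit_iff.mp H)

/-- AF⁺ on down-sets implies the pair node (p599518). -/
theorem stub_pairJoinWideLower_of_afitLower : Stmt.stub_afitLower → Stmt.stub_pairJoinWideLower :=
  fun H => LowerNode.pairJoinWideLower_of_universalJoinWideLower (LowerNode.universalJoinWideLower_of_afitLower H)

/-- the universal node implies the pair node (p599518). -/
theorem stub_pairJoinWideLower_of_universalJoinWide : Stmt.stub_universalJoinWide → Stmt.stub_pairJoinWideLower :=
  fun H => LowerNode.pairJoinWideLower_of_universalJoinWideLower (LowerNode.universalJoinWideLower_of_universalJoinWide H)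

/-- **Fifth composition (v6, kernel-checked): AF⁺ on down-sets closes the crux** (b = 12 wide join door + down-compression, p599518). -/
theorem PartitionMinorsHitByVP_of_afitLower : Stmt.stub_afitLower → PartitionMinorsHitByVP :=
  fun H => LowerNode.partitionMinorsHitByVP_of_afitLower H

/-- **Sixth composition (v6, kernel-checked): the pair node on lower sets closes the crux** (p599518). -/
theorem PartitionMinorsHitByVP_of_pairJoinWideLower : Stmt.stub_pairJoinWideLower → ItemByName :=
  fun H => LowerNode.partitionMinorsHitByVP_of_pairJoinWideLower H

/-- `Stmt.stub_fullJoinPairLower` is literally p3 g16's typed node (p672719). -/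
theorem stub_fullJoinPairLower_iff : Stmt.stub_fullJoinPairLower ↔ FullJoin.Stmt.fullJoinPairLower := Iff.rfl

/-- **R20 arrow (v9): the old pair node implies the registered full-join pair node** (p672719 `FullJoin.fullJoinPairLower_of_pairJoinWideLower`). -/
theorem stub_fullJoinPairLower_of_pairJoinWideLower : Stmt.stub_pairJoinWideLower → Stmt.stub_fullJoinPairLower :=
  fun H => FullJoin.fullJoinPairLower_of_pairJoinWideLower (stub_pairJoinWideLower_iff.mp H)

/-- AF⁺ on down-sets ⇒ the full-join pair node (via the pair node). -/
theorem stub_fullJoinPairLower_of_afitLower : Stmt.stub_afitLower → Stmt.stub_fullJoinPairLower :=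
  fun H => stub_fullJoinPairLower_of_pairJoinWideLower (stub_pairJoinWideLower_of_afitLower H)

/-- the universal node ⇒ the full-join pair node (via the pair node). -/
theorem stub_fullJoinPairLower_of_universalJoinWide : Stmt.stub_universalJoinWide → Stmt.stub_fullJoinPairLower :=
  fun H => stub_fullJoinPairLower_of_pairJoinWideLower (stub_pairJoinWideLower_of_universalJoinWide H)

/-- **By-name credit (v9): CONJECTURE FJ (one cube, `K ≤ h`; `FullJoin.Stmt.fullJoinCubePairLower`, p672719) implies the registered full-join pair node.** -/
theorem stub_fullJoinPairLower_of_fullJoinCube : FullJoin.Stmt.fullJoinCubePairLower → Stmt.stub_fullJoinPairLower :=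
  fun H => FullJoin.fullJoinPairLower_of_cube H

/-- **Ninth composition (v9, kernel-checked): the full-join pair node closes the crux** (FULL-JOIN DOOR p672458 + down-compression, `b = 12`; p672719). -/
theorem PartitionMinorsHitByVP_of_fullJoinPairLower : Stmt.stub_fullJoinPairLower → PartitionMinorsHitByVP :=
  fun H => FullJoin.partitionMinorsHitByVP_of_fullJoinPairLower (stub_fullJoinPairLower_iff.mp H)

/-- CONJECTURE FJ closes the crux (by name; p672719). -/
theorem PartitionMinorsHitByVP_of_fullJoinCube : FullJoin.Stmt.fullJoinCubePairLower → ItemByName :=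
  fun H => FullJoin.partitionMinorsHitByVP_of_fullJoinCubePairLower H

theorem stub_majorityJoinWideLower_iff : Stmt.stub_majorityJoinWideLower ↔ LowerNode.Stmt.majorityJoinWideLower := Iff.rfl

/-- majority ⇒ pair node (pigeonhole, p605313). -/
theorem stub_pairJoinWideLower_of_majority : Stmt.stub_majorityJoinWideLower → Stmt.stub_pairJoinWideLower :=
  fun H => LowerNode.pairJoinWideLower_of_majority H

/-- majority ⇒ the registered full-join pair node (v9). -/
theorem stub_fullJoinPairLower_of_majority : Stmt.stub_majorityJoinWideLower → Stmt.stub_fullJoinPairLower :=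
  fun H => stub_fullJoinPairLower_of_pairJoinWideLower (stub_pairJoinWideLower_of_majority H)

/-- universal node ⇒ majority node (a one-element list, p605313). -/
theorem stub_majorityJoinWideLower_of_universalJoinWide : Stmt.stub_universalJoinWide → Stmt.stub_majorityJoinWideLower :=
  fun H => LowerNode.majority_of_universalJoinWideLower (LowerNode.universalJoinWideLower_of_universalJoinWide H)

/-- **Seventh composition (v7, kernel-checked): the majority node closes the crux** (p605313). -/
theorem PartitionMinorsHitByVP_of_majority : Stmt.stub_majorityJoinWideLower → PartitionMinorsHitByVP :=
  fun H => LowerNode.partitionMinorsHitByVP_of_majority H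

theorem stub_simplexPairLower_iff : Stmt.stub_simplexPairLower ↔ Stmt.simplexPairLower := Iff.rfl

/-- p3 g11's universal simplex node implies the registered pair node (p610840). -/
theorem stub_simplexPairLower_of_simplexUniversal : Stmt.simplexUniversal → Stmt.stub_simplexPairLower :=
  fun H => simplexPairLower_of_simplexUniversal H

/-- **By-name credit (v8): p3 g11's SIMPLEX UNIFORM MENU node (p623583) implies the registered pair node** (`good_of_uniform_pieces`, p621024). -/
theorem stub_simplexPairLower_of_uniformMenuSimplex : Stmt.uniformMenuSimplex → Stmt.stub_simplexPairLower :=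
  fun H => simplexPairLower_of_simplexUniversal (simplexUniversal_of_uniformMenuSimplex H)

/-- **By-name credit (v8): p3 g11's WIDE UNIFORM MENU node (p623583) implies the registered universal wide node** (`good_of_uniform_pieces_join`, p622521). -/
theorem stub_universalJoinWide_of_uniformMenuWide : Stmt.uniformMenuWide → Stmt.stub_universalJoinWide :=
  fun H => universalJoinWide_of_uniformMenuWide H

/-- **Eighth composition (v8 DRAFT, kernel-checked): the exact-support pair node closes the crux** (b = 14, p610840). -/
theorem PartitionMinorsHitByVP_of_simplexPairLower : Stmt.stub_simplexPairLower → PartitionMinorsHitByVP :=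
  fun H => partitionMinorsHitByVP_of_simplexPairLower H

end Summit.ValiantsHypothesis.ValiantsHypothesis.Cruxes.PartitionMinorsHitByVP.HiddenStates
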